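import Summits.Ventures.PercRepro.S2ClusterFour
import Summits.Ventures.PercRepro.S2ThirteenSixSix

/-!
# PercRepro — S2: THE ROWS `t = 4, 5` OF THE `(13, 6)` SPREAD CASE BY THE FIVE SHAPES; THE CELL `(13, 6)` MODULO `t ≤ 3`
(p7, gen 15; sub-claim S2)

Three pairwise disjoint triangles (`c025_thirteen_six_cf_spread_of_three_disjoint'`, `t ≥ 3`: `U ≤ 16317` against
`16534 / 16497`) or one of the five shapes of `S2.exists_clusters_of_no_three_disjoint_four`: A — a `6`-point cluster of nullity
`3` alone (`U ≤ 6969 + 6051`); B — `(≤ 7, 3) + (≤ 3, 1)` (`5873 + 7371`); C — `(≤ 7, 3) + (≤ 5, 2)` (`3150 + 5635`); D —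
`(≤ 7, 3) + (≤ 7, 3)` (`1225 + 3675`); E — `(≤ 5, 2) + (≤ 5, 2)` (`5600 + 7750`): `U ≤ 13350` in every shape
(**`c025_thirteen_six_cf_spread_four_five`**), hence the spread case at every `t ≥ 4` (**`c025_thirteen_six_cf_spread_ge_four`**)
and **`c025_core_five_thirteen_six_of_three (hcf3 : … → #triangles ≤ 3 → RLS M 13 5) : RLS M 13 5`** — the cell `(13, 6)` modulo
only its coloop-free spread rows `t ≤ 3`. NO cell and NO window move is claimed. Axioms: standard.
-/

open scoped Matroid

namespace PercRepro

namespace ThmN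

open Set

variable {α : Type}

/-- **The spread case of the coloop-free cell `(13, 6)` at `t = 4, 5` triangles.** -/
theorem c025_thirteen_six_cf_spread_four_five (M : Matroid α) [M.Finite]
    (hR : M.eRank = ((13 : ℕ) : ℕ∞)) (hn : M.E.ncard = 13 + 6)
    (hfree : ∀ e ∈ M.E, ∃ A ⊆ M.E \ {e}, e ∉ M.closure A ∧ e ∉ M.closure ((M.E \ {e}) \ A)) (hK : ∀ e, ¬ M.IsColoop e)
    (h4 : ¬ ∃ W ⊆ M.E, W.ncard ≤ 9 ∧ W.encard = M.eRk W + 4)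
    (ht4 : 4 ≤ {C : Set α | M.IsCircuit C ∧ C.ncard = 3}.ncard)
    (ht5 : {C : Set α | M.IsCircuit C ∧ C.ncard = 3}.ncard ≤ 5) : RLS M 13 5 := by
  classical
  have hd : M.E.encard = M.eRank + ((6 : ℕ) : ℕ∞) := by
    rw [hR, ← M.ground_finite.cast_ncard_eq, hn]
    push_cast
    ring
  obtain ⟨hs3, hs4, hs5⟩ := caps_thirteen_six_cf M hd hn hfree hK
  have hflat : ∀ X ⊆ M.E, M.eRk X ≤ 5 → X.ncard ≤ 8 := fun X hX hr => by
    have := S2.ncard_le_of_eRk_le_of_not_nullity M 4 9 (by norm_num) h4 hX (r := 5) (by norm_num) (by exact_mod_cast hr)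
    omega
  have hflat' : ∀ X ⊆ M.E, M.eRk X ≤ 4 → X.ncard ≤ 7 := fun X hX hr => by
    have := S2.ncard_le_of_eRk_le_of_not_nullity M 4 9 (by norm_num) h4 hX (r := 4) (by norm_num) (by exact_mod_cast hr)
    omega
  have hs : ∀ e ∈ M.E, ∀ f ∈ M.E, e ≠ f → M.eRk {e, f} = 2 := by
    intro e he f hf hef
    have h2 : (2 : ℕ∞) ≤ M.eRk {e, f} :=
      two_le_eRk_of_two_le_ncard_of_free M hfree (pair_subset he hf) (by rw [ncard_pair hef])
    have h3 : M.eRk {e, f} ≤ 2 := by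
      have := M.eRk_le_encard {e, f}
      rwa [encard_pair hef] at this
    exact le_antisymm h3 h2
  have hC1 : ∀ L ⊆ M.E, M.eRk L = 2 → L.ncard ≤ 3 :=
    fun L hL hr => ncard_le_three_of_eRk_two M hs hfree hL hr
  have hTfin : {C : Set α | M.IsCircuit C ∧ C.ncard = 3}.Finite :=
    M.ground_finite.finite_subsets.subset (fun C hC => hC.1.subset_ground)
  have h9 : ∀ X ⊆ M.E, X.ncard ≤ 9 → X.encard ≤ M.eRk X + 3 := by
    intro X hX hX9
    by_contra hlt
    push Not at hlt
    have hk : M.eRk X + 4 ≤ X.encard := by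
      have := Order.add_one_le_of_lt hlt
      rwa [add_assoc, show (3 : ℕ∞) + 1 = 4 by norm_num] at this
    obtain ⟨W', hW'X, hW'⟩ := S2.exists_subset_encard_eq_eRk_add M hX 4 hk
    exact h4 ⟨W', hW'X.trans hX, (Set.ncard_le_ncard hW'X (M.ground_finite.subset hX)).trans hX9, hW'⟩
  by_cases h3 : ∃ T₁ T₂ T₃ : Set α, M.IsCircuit T₁ ∧ T₁.ncard = 3 ∧ M.IsCircuit T₂ ∧ T₂.ncard = 3 ∧
      M.IsCircuit T₃ ∧ T₃.ncard = 3 ∧ Disjoint T₁ T₂ ∧ Disjoint T₁ T₃ ∧ Disjoint T₂ T₃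
  · obtain ⟨T₁, T₂, T₃, hT₁, hT₁3, hT₂, hT₂3, hT₃, hT₃3, d12, d13, d23⟩ := h3
    exact c025_thirteen_six_cf_spread_of_three_disjoint' M hR hn hfree hK h4 (by omega) hT₁ hT₁3 hT₂ hT₂3 hT₃ hT₃3 d12 d13 d23
  -- the cell inequality
  have cellA : ∀ (U S m : ℕ) (A : ℚ), Matroid.topCount M 13 5 ≤ U →
      {X : Set α | X ⊆ M.E ∧ M.eRk X = M.eRank}.ncard ≤ S → m ≤ 1024 →
      1024 * (U : ℚ) ≤ ((1024 - m : ℕ) : ℚ) * 2 ^ (6 - 5) * (9480 : ℚ) →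
      (1024 : ℚ) * (A + (S : ℚ)) ≤ (m : ℚ) * 2 ^ 19 →
      ({X : Set α | X ⊆ M.E ∧ M.eRk X ≤ 5}.ncard : ℚ) ≤ A → RLS M 13 5 := by
    intro U S m A hU hS hm hpoly htail hA
    rw [RLS_iff]
    exact c025_core_five_cell_of_counts_xqictq5g M 13 6 (by norm_num) hR hn U hU _ hA S hS
      9480 (by norm_num) (phiK 13 5) (by rw [phiK_thirteen_five]; norm_num) ⟨m, hm, hpoly, htail⟩
  have hU1 := S2.topCount_le_ncard_compl_spanning (M := M) hR hd 5
  simp only [Nat.cast_ofNat] at hU1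
  have hsplit : {B : Set α | B ⊆ M.E ∧ M.eRk B = 5 ∧ B.ncard ≤ 6 ∧ M.eRk (M.E \ B) = M.eRank}.ncard ≤
      {B : Set α | B ⊆ M.E ∧ B.ncard = 5 ∧ M.eRk B = 5 ∧ M.eRk (M.E \ B) = M.eRank}.ncard +
      {B : Set α | B ⊆ M.E ∧ B.ncard = 6 ∧ M.eRk B = 5 ∧ M.eRk (M.E \ B) = M.eRank}.ncard := by
    refine le_trans (Set.ncard_le_ncard ?_ ((M.ground_finite.finite_subsets.subset (fun B hB => hB.1)).union
      (M.ground_finite.finite_subsets.subset (fun B hB => hB.1)))) (Set.ncard_union_le _ _)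
    rintro B ⟨hBE, hB5, hB6, hBs⟩
    have hBfin : B.Finite := M.ground_finite.subset hBE
    have h5le : 5 ≤ B.ncard := by
      have := M.eRk_le_encard B
      rw [hB5, ← hBfin.cast_ncard_eq] at this
      exact_mod_cast this
    rcases (show B.ncard = 5 ∨ B.ncard = 6 by omega) with h | h
    · exact Or.inl ⟨hBE, h, hB5, hBs⟩
    · exact Or.inr ⟨hBE, h, hB5, hBs⟩
  have hUsum := hU1.trans hsplit
  -- THE TOP COUNT `≤ 13350` by the five shapes
  have hU' : Matroid.topCount M 13 5 ≤ 13350 := by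
    rcases S2.exists_clusters_of_no_three_disjoint_four M hC1 h9 ht4 h3 with ⟨W₁, hW₁, hW₁6, hW₁3⟩ |
      ⟨W₁, W₂, k₁, k₂, hW₁, hW₂, hdis, hk₁, hk₂, hcases⟩
    · -- shape A: the cluster alone (the second cluster empty)
      have hk₂ : M.eRk (∅ : Set α) + 0 ≤ (∅ : Set α).encard := by simp
      obtain ⟨htop6, htop5⟩ := S2.top_sets_le_of_two_clusters M hR hn hW₁ (Set.empty_subset _) (Set.disjoint_empty W₁) hW₁3 hk₂
      rw [Set.ncard_empty] at htop6 htop5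
      have hnum : (∑ i ∈ Finset.Icc 3 6, ∑ j ∈ Finset.Icc 0 (6 - i), W₁.ncard.choose i * (Nat.choose 0 j *
              ((13 + 6) - W₁.ncard - 0).choose (6 - i - j))) ≤ 6969 ∧
          (∑ i ∈ Finset.Icc (3 - 1) 5, ∑ j ∈ Finset.Icc (0 - 1) (5 - i), W₁.ncard.choose i * (Nat.choose 0 j *
              ((13 + 6) - W₁.ncard - 0).choose (5 - i - j))) ≤ 6051 := by
        generalize W₁.ncard = w at hW₁6 ⊢
        interval_cases w <;> decide
      have h6 := htop6.trans hnum.1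
      have h5 := htop5.trans hnum.2
      omega
    · obtain ⟨htop6, htop5⟩ := S2.top_sets_le_of_two_clusters M hR hn hW₁ hW₂ hdis hk₁ hk₂
      rcases hcases with ⟨hw₁, rfl, hw₂, rfl⟩ | ⟨hw₁, rfl, hw₂, rfl⟩ | ⟨hw₁, rfl, hw₂, rfl⟩ | ⟨hw₁, rfl, hw₂, rfl⟩
      · have hnum : (∑ i ∈ Finset.Icc 3 6, ∑ j ∈ Finset.Icc 1 (6 - i), W₁.ncard.choose i * (W₂.ncard.choose j *
              ((13 + 6) - W₁.ncard - W₂.ncard).choose (6 - i - j))) ≤ 5873 ∧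
            (∑ i ∈ Finset.Icc (3 - 1) 5, ∑ j ∈ Finset.Icc (1 - 1) (5 - i), W₁.ncard.choose i * (W₂.ncard.choose j *
              ((13 + 6) - W₁.ncard - W₂.ncard).choose (5 - i - j))) ≤ 7371 := by
          generalize W₁.ncard = w₁ at hw₁ ⊢
          generalize W₂.ncard = w₂ at hw₂ ⊢
          interval_cases w₁ <;> interval_cases w₂ <;> decide
        have h6 := htop6.trans hnum.1
        have h5 := htop5.trans hnum.2
        omega
      · have hnum : (∑ i ∈ Finset.Icc 3 6, ∑ j ∈ Finset.Icc 2 (6 - i), W₁.ncard.choose i * (W₂.ncard.choose j *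
              ((13 + 6) - W₁.ncard - W₂.ncard).choose (6 - i - j))) ≤ 3150 ∧
            (∑ i ∈ Finset.Icc (3 - 1) 5, ∑ j ∈ Finset.Icc (2 - 1) (5 - i), W₁.ncard.choose i * (W₂.ncard.choose j *
              ((13 + 6) - W₁.ncard - W₂.ncard).choose (5 - i - j))) ≤ 5635 := by
          generalize W₁.ncard = w₁ at hw₁ ⊢
          generalize W₂.ncard = w₂ at hw₂ ⊢
          interval_cases w₁ <;> interval_cases w₂ <;> decide
        have h6 := htop6.trans hnum.1
        have h5 := htop5.trans hnum.2
        omega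
      · have hnum : (∑ i ∈ Finset.Icc 3 6, ∑ j ∈ Finset.Icc 3 (6 - i), W₁.ncard.choose i * (W₂.ncard.choose j *
              ((13 + 6) - W₁.ncard - W₂.ncard).choose (6 - i - j))) ≤ 1225 ∧
            (∑ i ∈ Finset.Icc (3 - 1) 5, ∑ j ∈ Finset.Icc (3 - 1) (5 - i), W₁.ncard.choose i * (W₂.ncard.choose j *
              ((13 + 6) - W₁.ncard - W₂.ncard).choose (5 - i - j))) ≤ 3675 := by
          generalize W₁.ncard = w₁ at hw₁ ⊢
          generalize W₂.ncard = w₂ at hw₂ ⊢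
          interval_cases w₁ <;> interval_cases w₂ <;> decide
        have h6 := htop6.trans hnum.1
        have h5 := htop5.trans hnum.2
        omega
      · have hnum : (∑ i ∈ Finset.Icc 2 6, ∑ j ∈ Finset.Icc 2 (6 - i), W₁.ncard.choose i * (W₂.ncard.choose j *
              ((13 + 6) - W₁.ncard - W₂.ncard).choose (6 - i - j))) ≤ 5600 ∧
            (∑ i ∈ Finset.Icc (2 - 1) 5, ∑ j ∈ Finset.Icc (2 - 1) (5 - i), W₁.ncard.choose i * (W₂.ncard.choose j *
              ((13 + 6) - W₁.ncard - W₂.ncard).choose (5 - i - j))) ≤ 7750 := by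
          generalize W₁.ncard = w₁ at hw₁ ⊢
          generalize W₂.ncard = w₂ at hw₂ ⊢
          interval_cases w₁ <;> interval_cases w₂ <;> decide
        have h6 := htop6.trans hnum.1
        have h5 := htop5.trans hnum.2
        omega
  -- the spanning count and the tail
  have hS' : {X : Set α | X ⊆ M.E ∧ M.eRk X = M.eRank}.ncard ≤ 28781 := by
    obtain ⟨T₁, T₂, T₃, hT₁, hT₂, hT₃, h12, h13, h23⟩ := (Set.two_lt_ncard_iff hTfin).1 (by omega)
    have hS := S2.ncard_spanning_add_le_of_three_triangles M hR hn (by norm_num) hC1 hT₁.1 hT₁.2 hT₂.1 hT₂.2 hT₃.1 hT₃.2 h12 h13 h23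
    norm_num [Finset.sum_range_succ, Nat.choose] at hS
    omega
  obtain ⟨t, ht⟩ : ∃ t, {C : Set α | M.IsCircuit C ∧ C.ncard = 3}.ncard = t := ⟨_, rfl⟩
  have hA := ncard_eRk_le_five_le_spread M 13 6 (by norm_num) hR hn hfree hflat hflat' t 35 158 ht.le hs4 hs5
  rw [ht] at ht4 ht5
  rcases (show t = 4 ∨ t = 5 by omega) with ht4e | ht5e
  · subst ht4e
    exact cellA _ 28781 131 _ hU' hS' (by norm_num) (by norm_num) (by norm_num [Nat.choose]) hA
  · subst ht5e
    exact cellA _ 28781 133 _ hU' hS' (by norm_num) (by norm_num) (by norm_num [Nat.choose]) hA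

/-- **The spread case of the coloop-free cell `(13, 6)` at every `t ≥ 4`.** -/
theorem c025_thirteen_six_cf_spread_ge_four (M : Matroid α) [M.Finite]
    (hR : M.eRank = ((13 : ℕ) : ℕ∞)) (hn : M.E.ncard = 13 + 6)
    (hfree : ∀ e ∈ M.E, ∃ A ⊆ M.E \ {e}, e ∉ M.closure A ∧ e ∉ M.closure ((M.E \ {e}) \ A)) (hK : ∀ e, ¬ M.IsColoop e)
    (h4 : ¬ ∃ W ⊆ M.E, W.ncard ≤ 9 ∧ W.encard = M.eRk W + 4)
    (ht4 : 4 ≤ {C : Set α | M.IsCircuit C ∧ C.ncard = 3}.ncard) : RLS M 13 5 := by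
  by_cases ht6 : 6 ≤ {C : Set α | M.IsCircuit C ∧ C.ncard = 3}.ncard
  · exact c025_thirteen_six_cf_spread_ge_six M hR hn hfree hK h4 ht6
  · exact c025_thirteen_six_cf_spread_four_five M hR hn hfree hK h4 ht4 (by omega)

/-- **The cell `(13, 6)` modulo the spread rows `t ≤ 3` of its coloop-free case.** -/
theorem c025_core_five_thirteen_six_of_three
    (hcf3 : ∀ (M : Matroid α) [M.Finite], M.eRank = ((13 : ℕ) : ℕ∞) → M.E.ncard = 13 + 6 →
      (∀ e ∈ M.E, ∃ A ⊆ M.E \ {e}, e ∉ M.closure A ∧ e ∉ M.closure ((M.E \ {e}) \ A)) → (∀ e, ¬ M.IsColoop e) →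
      ¬ (∃ W ⊆ M.E, W.ncard ≤ 9 ∧ W.encard = M.eRk W + 4) →
      {C : Set α | M.IsCircuit C ∧ C.ncard = 3}.ncard ≤ 3 → RLS M 13 5)
    (M : Matroid α) [M.Finite]
    (hR : M.eRank = ((13 : ℕ) : ℕ∞)) (hn : M.E.ncard = 13 + 6)
    (hfree : ∀ e ∈ M.E, ∃ A ⊆ M.E \ {e}, e ∉ M.closure A ∧ e ∉ M.closure ((M.E \ {e}) \ A)) : RLS M 13 5 := by
  refine c025_core_five_thirteen_six_of_five ?_ M hR hn hfree
  intro M _ hR hn hfree hK h4 ht5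
  by_cases ht3 : {C : Set α | M.IsCircuit C ∧ C.ncard = 3}.ncard ≤ 3
  · exact hcf3 M hR hn hfree hK h4 ht3
  · exact c025_thirteen_six_cf_spread_four_five M hR hn hfree hK h4 (by omega) ht5

end ThmN

end PercRepro
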